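import Mathlib
import HarnessLib
import Summits.Ventures.LatticeQCDFlow.StatementSharp
import Summits.Ventures.LatticeQCDFlow.TrivializingMaps.WilsonFisherZerosAnyGroup
import Summits.Ventures.LatticeQCDFlow.TrivializingMaps.StrongCouplingSpecificHeat
import Summits.Ventures.LatticeQCDFlow.TrivializingMaps.ReweightingStepLaw

/-!
# Venture statement — LatticeQCDFlow — DRAFT, Part T22: THE VOLUME-UNIFORM ZERO-FREE DISC OF THE
# FINITE-VOLUME WILSON PARTITION FUNCTION, BY NAME, AND THE EXTENSIVE COUNT AT THAT RADIUS

HONEST FRAMING: exact (Metropolis-corrected) sampling algorithms for lattice gauge theory;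
figures of merit are autocorrelation/cost numbers at stated couplings and volumes; no
continuum-physics claim.

This file CONTINUES the venture's `Statement.lean` DRAFT (FANOUT-PLAN.md row 31, lean-2; review-queued;
it STAYS A DRAFT until the operator adopts it), after `StatementSharp.lean` (Parts T16–T21, at the
tree's 400-line limit).  It is a separate (fifth, on the trivializing-map side) module only because of
that limit; on adoption the operator may merge them.  As before, every `Prop` is a typed statement over
the landed substrate with a `_holds` theorem next to it, and
`TheoryStatementT22 := TheoryStatementT21 ∧ T22` is PROVED.

Why a Part T22 (LEAD LINE 213, RT-30 (170); theory-1 GEN-34 statement audit §4, R6(b)).  Part T21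
(`T21_WilsonFisherZerosExtensive`) types the extensive count of Fisher zeros OUTSIDE some volume-uniform
radius `ρ > 0` (`∃ ρ, 0 < ρ ∧ …`, the counted zeros having `ρ ≤ ‖u‖`), but no Part types the zero-free
disc itself, so the packet words may not call `ρ` "the zero-free radius" as a typed referent.  Part
T22 supplies exactly that, with the radius NAMED:

* **T22 (i) (THE ZERO-FREE DISC, radius `1/θ₁(d, n, B)` by name)** — for every `d`, every `n ≠ 0`,
  every basis `B` of `𝔰𝔲(n)`, EVERY periodic volume `L ≥ 1` and every complex coupling `s` with
  `|s| < 1/θ₁(d, n, B)`: `Z_L(s) = ∫ D[U] e^{-sS_W} ≠ 0`, where `θ₁ = GradedSeries.theta1 d n B ≥ 1`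
  is the growth constant of the tree's PROVED THEOREM A (`GradedTheoremA.mass_pack_le`: the link
  gradients of Lüscher's series `S̃^{(k)}` grow at most like `θ₁^k`, uniformly in the volume), so that
  the re-expanded flow-constant series converge on `|s| < 1/θ₁` in every volume and `Z_L` cannot
  vanish there (`TrivializingMaps.wilson_actionZ_zeroFree_theta1`, THEOREM F′);
* **T22 (ii) (THE EXTENSIVE COUNT AT THAT RADIUS)** — for `n ≥ 2`, every `L ≥ 2` and every `R > 0`:
  the zeros `u` of `Z_L` with `1/θ₁(d, n, B) ≤ |u| < R` have total multiplicity (Mathlib's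
  `MeromorphicOn.divisor` on `closedBall 0 (2R)`) at least `θ₁⁻² · (m₂(n) − 4n/R) · #plaquettes(d, L)`,
  `m₂(n) = ∫_{SU(n)} (Re tr)² dHaar` (`TrivializingMaps.wilson_fisherZeros_extensive_explicit`; `m₂(2) = 1`,
  `m₂(n) = ½` for `n ≥ 3` by `PlaquetteHaarMoments` / `HaarTraceMomentsSUn`).

`T21_of_T22`: T22 (ii) implies Part T21 as typed (take `ρ := 1/θ₁`), so the new Part REPLACES nothing.
The two `Prop`s are theory-1's typing aid `T21SameSideScratch.lean` (GEN-34, R6(b)) made a tree Part.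

NOT part of the binding text: the numerical VALUE of `θ₁(d, n, B)` (an explicit but unevaluated finite
expression in `d`, `n` and the basis `B` — `GradedTransfer.theta`, `GradedEmission.Gam`,
`GradedMasses.tauStar/sigmaStar`); whether `1/θ₁` is the largest zero-free radius (T17: it is at most
`8` for `SU(2)`, `8n` for `n ≥ 3`); any count for a concrete volume; `L = 1` in (ii); cost /
autocorrelation / continuum statements.
-/

namespace Summit.Ventures.LatticeQCDFlow

open MeasureTheory ProbabilityTheory Metric
open Literature.MathematicalPhysics.QuantumFieldTheory
open Literature.MathematicalPhysics.QuantumFieldTheory.Luscher2010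
open Literature.MathematicalPhysics.QuantumFieldTheory.WilsonFlow (coeConfig)
open scoped Matrix Matrix.Norms.Frobenius ContDiff

section PartT22

/-- **T22 — THE VOLUME-UNIFORM ZERO-FREE DISC OF RADIUS `1/θ₁(d, n, B)` AND THE EXTENSIVE COUNT AT THAT
RADIUS**: (i) for every `d`, `n ≠ 0`, basis `B` of `𝔰𝔲(n)`, every `L` and every `s` with
`‖s‖ < (θ₁ d n B)⁻¹`, the `SU(n)` Wilson partition function `Z_L(s) = ∫ D[U] e^{-sS_W}` is non-zero;
(ii) for `n ≥ 2`, every `L ≥ 2`, every `R > 0`: a finite set of zeros `u` of `Z_L` with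
`(θ₁ d n B)⁻¹ ≤ ‖u‖ < R`, each of multiplicity `≥ 1`, of total multiplicity at least
`(θ₁ d n B)⁻² · (m₂(n) − 4n/R) · #plaquettes`. -/
def T22_WilsonZeroFreeDiscNamed : Prop :=
  (∀ (d n : ℕ), n ≠ 0 → ∀ (B : SuBasis n) (L : ℕ) [NeZero L] (s : ℂ),
    ‖s‖ < (TrivializingMaps.GradedSeries.theta1 d n B)⁻¹ →
      complexMGF (fun U => -TrivializingMaps.ambWilsonAction (coeConfig U))
        (trivialMeasure (Matrix.specialUnitaryGroup (Fin n) ℂ) d L) s ≠ 0) ∧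
  (∀ (d n : ℕ), 2 ≤ n → ∀ (B : SuBasis n) (L : ℕ) [NeZero L], 2 ≤ L → ∀ R : ℝ, 0 < R →
    ∃ T : Finset ℂ, (∀ u ∈ T,
        complexMGF (fun U => -TrivializingMaps.ambWilsonAction (coeConfig U))
            (trivialMeasure (Matrix.specialUnitaryGroup (Fin n) ℂ) d L) u = 0 ∧
          (TrivializingMaps.GradedSeries.theta1 d n B)⁻¹ ≤ ‖u‖ ∧ ‖u‖ < R ∧
          1 ≤ MeromorphicOn.divisor (complexMGF (fun U => -TrivializingMaps.ambWilsonAction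
            (coeConfig U)) (trivialMeasure (Matrix.specialUnitaryGroup (Fin n) ℂ) d L))
            (Metric.closedBall (0 : ℂ) (2 * R)) u) ∧
      (TrivializingMaps.GradedSeries.theta1 d n B)⁻¹ ^ 2 *
          ((∫ g, ((g : Matrix (Fin n) (Fin n) ℂ)).trace.re ^ 2
            ∂(haarProbability (Matrix.specialUnitaryGroup (Fin n) ℂ))) - 4 * n / R) *
          Fintype.card (Plaquette d L) ≤
        ∑ u ∈ T, (MeromorphicOn.divisor (complexMGF (fun U => -TrivializingMaps.ambWilsonAction
            (coeConfig U)) (trivialMeasure (Matrix.specialUnitaryGroup (Fin n) ℂ) d L))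
            (Metric.closedBall (0 : ℂ) (2 * R)) u : ℝ))

/-- T22 holds (`TrivializingMaps.wilson_actionZ_zeroFree_theta1` for (i),
`TrivializingMaps.wilson_fisherZeros_extensive_explicit` for (ii)). -/
theorem T22_WilsonZeroFreeDiscNamed_holds : T22_WilsonZeroFreeDiscNamed :=
  ⟨fun _ _ hn B L _ s hs => TrivializingMaps.wilson_actionZ_zeroFree_theta1 hn B L s hs,
    fun _ _ hn B L _ hL R hR => TrivializingMaps.wilson_fisherZeros_extensive_explicit hn B L hL R hR⟩

/-- T22 (ii) implies Part T21 as typed (`ρ := 1/θ₁(d, n, B) > 0`): the named Part replaces nothing. -/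
theorem T21_of_T22 (h : T22_WilsonZeroFreeDiscNamed) : T21_WilsonFisherZerosExtensive :=
  fun d n hn B => ⟨(TrivializingMaps.GradedSeries.theta1 d n B)⁻¹,
    inv_pos.2 (zero_lt_one.trans_le (TrivializingMaps.GradedSeries.one_le_theta1 d n B)),
    fun L _ hL R hR => h.2 d n hn B L hL R hR⟩

end PartT22

/-- **The theory conjunction with the named zero-free disc** (DRAFT): `TheoryStatementT21 ∧ T22`. -/
def TheoryStatementT22 : Prop :=
  TheoryStatementT21 ∧ T22_WilsonZeroFreeDiscNamed

/-- The extended theory conjunction holds. -/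
theorem TheoryStatementT22_holds : TheoryStatementT22 :=
  ⟨TheoryStatementT21_holds, T22_WilsonZeroFreeDiscNamed_holds⟩



/-! ### Appended (lean-2 GEN-8, second pass): Parts T23–T25 — THE FINITE-VOLUME FISHER-ZERO PICTURE
WITH CLOSED-FORM CONSTANTS FOR EVERY COMPACT GAUGE GROUP, THE STRONG-COUPLING SPECIFIC HEAT
UNIFORMLY IN THE VOLUME, AND THE ONE-STEP REWEIGHTING LAW

* **T23** (`TrivializingMaps/WilsonZeroFreeKP`, `…/PlaquetteDecorrelation`, `…/U1WilsonFisherZero`,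
  `…/WilsonFisherZerosAnyGroup`) — for a compact gauge group `G` and a continuous unitary-valued
  `N`-dimensional matrix representation `ρ`, with `r(d, N) := 1/(4e · max(1, 2N) · (3^d d² + 1)²)` and
  `v_ρ := Var_Haar(Re tr ρ)`: (i) in EVERY volume `Z_L(s) = ∫ D[U] e^{-sS_W^ρ} ≠ 0` for `|s| ≤ r(d, N)`
  (the Kotecký–Preiss disc of the torus plaquette system, docked onto Lüscher's `Z_L`); (ii) for `G`
  second countable, `v_ρ > 0`, `d ≥ 2` and every `L ≥ 2`: a zero with `|s₀| ≤ 4N / v_ρ` (at β = 0 a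
  class function of one plaquette is uncorrelated with any function of another, so
  `Var_{D[U]}(S_W^ρ) = #plaq · v_ρ`); (iii) for every `L ≥ 2`, `R > 0`: zeros with `r ≤ |u| < R` of total
  multiplicity at least `r² · (v_ρ − 4N/R) · #plaquettes`; (iv) `U(1)` (`v = ½`): a zero with `|s₀| ≤ 8`
  in every volume `L ≥ 2`, `d ≥ 2`, and none with `|s| ≤ 1/(8e(3^d d² + 1)²)`.
* **T24** (`TrivializingMaps/StrongCouplingSpecificHeat`) — `SU(n)`, `n ≥ 2`, `r = r(d, n) =
  1/(8e·n·(3^d d² + 1)²)`, variance of `S_W` under `wilsonMeasure ρ₀ x`: (i) for every `L ≥ 2` and real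
  `|x| < r/4`: `|Var_x(S_W) − m₂(n)·#plaq| ≤ 256 · #plaq · |x| / r³`; (ii) for every `L` and `|x| < r/2`:
  `Var_x(S_W) ≤ 32 · #plaq / r²`; (iii) for `d ≥ 2`, every `L ≥ 2` and `|x| ≤ min (r/8) (m₂(n) r³/512)`:
  `dist(x, F_{Z_L}) ≤ 8n / m₂(n)`.

* **T25** (`TrivializingMaps/ReweightingStepLaw`) — for every smooth action `S` on `SU(n)^E`, every
  volume, every real `β` and `δ ≥ 0`, with `ψ = log Z` the cumulant generating function of `-S∘ι`:
  the second moment of the one-step reweighting weight `dμ_{β+δ}/dμ_β = e^{-δS}Z(β)/Z(β+δ)` is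
  `exp(ψ(β+2δ) − 2ψ(β+δ) + ψ(β))`, and lies in `[exp(δ²m), exp(δ²M)]` whenever `m ≤ Var_u(S∘ι) ≤ M` on
  `[β, β+2δ]`; for the `SU(n)` Wilson action with `[β, β+2δ]` inside T24's window:
  `≥ exp(δ²·m₂(n)·#plaq/2)` — exponential in the volume at fixed step.

NOT binding: optimality of any constant (`r` is astronomically small — `(3^4·16+1)² = 1297²` in
`d = 4` — but depends on `d` and `N` alone); anything at `|x| ≥ r/4`; `L = 1`; any finite-sample ESS
statement (T25 is about the second moment `1 + χ²` only); cost / autocorrelation / continuum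
statements.  `TheoryStatementT25 := TheoryStatementT22 ∧ T23 ∧ T24 ∧ T25` is PROVED. -/

section PartT23

/-- **T23 — THE FINITE-VOLUME FISHER ZEROS OF THE WILSON PARTITION FUNCTION, EVERY COMPACT GAUGE GROUP,
CLOSED-FORM CONSTANTS**: (i) zero-free disc `|s| ≤ 1/(4e·max(1,2N)·(3^d d²+1)²)`, every volume;
(ii) a zero with `|s₀| ≤ 4N/Var_Haar(Re tr ρ)`, every `L ≥ 2` (`d ≥ 2`); (iii) zeros with
`r ≤ |u| < R` of total multiplicity `≥ r²·(Var_Haar(Re tr ρ) − 4N/R)·#plaq`, every `L ≥ 2`;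
(iv) `U(1)`: a zero with `|s₀| ≤ 8` (`d, L ≥ 2`) and none with `|s| ≤ 1/(8e(3^d d²+1)²)`. -/
def T23_WilsonFisherZerosAnyGroup : Prop :=
  (∀ (d L N : ℕ) [NeZero L] (G : Type) [Group G] [TopologicalSpace G] [IsTopologicalGroup G]
      [CompactSpace G] [MeasurableSpace G] [BorelSpace G] (ρ : G →* Matrix (Fin N) (Fin N) ℂ),
      Continuous ρ → (∀ g, ρ g ∈ Matrix.unitaryGroup (Fin N) ℂ) → ∀ s : ℂ,
      ‖s‖ ≤ 1 / (4 * Real.exp 1 * max 1 (2 * (N : ℝ)) * ((3 : ℝ) ^ d * (d : ℝ) ^ 2 + 1) ^ 2) →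
      complexMGF (fun U => -wilsonAction ρ U) (trivialMeasure G d L) s ≠ 0) ∧
  (∀ (d L N : ℕ) [NeZero L] (G : Type) [Group G] [TopologicalSpace G] [IsTopologicalGroup G]
      [CompactSpace G] [MeasurableSpace G] [BorelSpace G] [SecondCountableTopology G]
      (ρ : G →* Matrix (Fin N) (Fin N) ℂ), Continuous ρ → 2 ≤ d → 2 ≤ L →
      0 < variance (fun g => (ρ g).trace.re) (haarProbability G) →
      ∃ s₀ : ℂ, ‖s₀‖ ≤ 4 * N / variance (fun g => (ρ g).trace.re) (haarProbability G) ∧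
        complexMGF (fun U => -wilsonAction ρ U) (trivialMeasure G d L) s₀ = 0) ∧
  (∀ (d L N : ℕ) [NeZero L] (G : Type) [Group G] [TopologicalSpace G] [IsTopologicalGroup G]
      [CompactSpace G] [MeasurableSpace G] [BorelSpace G] [SecondCountableTopology G]
      (ρ : G →* Matrix (Fin N) (Fin N) ℂ), Continuous ρ → (∀ g, ρ g ∈ Matrix.unitaryGroup (Fin N) ℂ) →
      2 ≤ L → ∀ R : ℝ, 0 < R →
      ∃ T : Finset ℂ, (∀ u ∈ T,
          complexMGF (fun U => -wilsonAction ρ U) (trivialMeasure G d L) u = 0 ∧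
            1 / (4 * Real.exp 1 * max 1 (2 * (N : ℝ)) * ((3 : ℝ) ^ d * (d : ℝ) ^ 2 + 1) ^ 2) ≤ ‖u‖ ∧
            ‖u‖ < R ∧
            1 ≤ MeromorphicOn.divisor (complexMGF (fun U => -wilsonAction ρ U) (trivialMeasure G d L))
              (Metric.closedBall (0 : ℂ) (2 * R)) u) ∧
        (1 / (4 * Real.exp 1 * max 1 (2 * (N : ℝ)) * ((3 : ℝ) ^ d * (d : ℝ) ^ 2 + 1) ^ 2)) ^ 2 *
            (variance (fun g => (ρ g).trace.re) (haarProbability G) - 4 * N / R) *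
            Fintype.card (Plaquette d L) ≤
          ∑ u ∈ T, (MeromorphicOn.divisor (complexMGF (fun U => -wilsonAction ρ U)
              (trivialMeasure G d L)) (Metric.closedBall (0 : ℂ) (2 * R)) u : ℝ)) ∧
  (∀ [MeasurableSpace Circle] [BorelSpace Circle] (d L : ℕ) [NeZero L], 2 ≤ d → 2 ≤ L →
      ∃ s₀ : ℂ, ‖s₀‖ ≤ 8 ∧
        complexMGF (fun U => -wilsonAction Literature.MathematicalPhysics.QuantumLattice.u1Rep U)
          (trivialMeasure Circle d L) s₀ = 0) ∧
  (∀ [MeasurableSpace Circle] [BorelSpace Circle] (d L : ℕ) [NeZero L] (s : ℂ),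
      ‖s‖ ≤ 1 / (8 * Real.exp 1 * ((3 : ℝ) ^ d * (d : ℝ) ^ 2 + 1) ^ 2) →
      complexMGF (fun U => -wilsonAction Literature.MathematicalPhysics.QuantumLattice.u1Rep U)
        (trivialMeasure Circle d L) s ≠ 0)

/-- T23 holds (`TrivializingMaps.wilsonZ_zeroFree_explicit`, `….wilsonZ_exists_zero_norm_le_uniform`,
`….wilsonZ_fisherZeros_extensive_anyGroup`, `….u1_wilsonZ_exists_zero_norm_le_eight`,
`….u1_wilsonZ_zeroFree_kp`). -/
theorem T23_WilsonFisherZerosAnyGroup_holds : T23_WilsonFisherZerosAnyGroup :=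
  ⟨fun _ _ _ _ _ _ _ _ _ _ _ ρ hρ hρu s hs => TrivializingMaps.wilsonZ_zeroFree_explicit ρ hρ hρu s hs,
    fun _ _ _ _ _ _ _ _ _ _ _ _ ρ hρ hd hL hv =>
      TrivializingMaps.wilsonZ_exists_zero_norm_le_uniform ρ hρ hd hL hv,
    fun _ _ _ _ _ _ _ _ _ _ _ _ ρ hρ hρu hL R hR =>
      TrivializingMaps.wilsonZ_fisherZeros_extensive_anyGroup ρ hρ hρu hL R hR,
    fun _ _ _ hd hL => TrivializingMaps.u1_wilsonZ_exists_zero_norm_le_eight hd hL,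
    fun _ _ _ s hs => TrivializingMaps.u1_wilsonZ_zeroFree_kp s hs⟩

end PartT23

section PartT24

/-- **T24 — THE SPECIFIC HEAT OF THE `SU(n)` WILSON THEORY AT STRONG COUPLING, UNIFORMLY IN THE
VOLUME** (`r = 1/(8e·n·(3^d d²+1)²)`, variance of `S_W` under `wilsonMeasure ρ₀ x`): (i) `n ≥ 2`,
`L ≥ 2`, `|x| < r/4`: `|Var_x(S_W) − m₂(n)·#plaq| ≤ 256·#plaq·|x|/r³`; (ii) `n ≥ 1`, every `L`,
`|x| < r/2`: `Var_x(S_W) ≤ 32·#plaq/r²`; (iii) `d ≥ 2`, `n ≥ 2`, `L ≥ 2`,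
`|x| ≤ min (r/8) (m₂(n) r³/512)`: `dist(x, F_{Z_L}) ≤ 8n/m₂(n)`. -/
def T24_StrongCouplingSpecificHeat : Prop :=
  (∀ (d L n : ℕ) [NeZero L], 2 ≤ n → 2 ≤ L → ∀ x : ℝ,
      |x| < 1 / (8 * Real.exp 1 * (n : ℝ) * ((3 : ℝ) ^ d * (d : ℝ) ^ 2 + 1) ^ 2) / 4 →
      |variance (wilsonAction (TrivializingMaps.StrongCoupling.defRep n))
            (wilsonMeasure (d := d) (L := L) (TrivializingMaps.StrongCoupling.defRep n) x) -
          (∫ g, ((g : Matrix (Fin n) (Fin n) ℂ)).trace.re ^ 2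
            ∂(haarProbability (Matrix.specialUnitaryGroup (Fin n) ℂ))) * Fintype.card (Plaquette d L)| ≤
        256 * Fintype.card (Plaquette d L) * |x| /
          (1 / (8 * Real.exp 1 * (n : ℝ) * ((3 : ℝ) ^ d * (d : ℝ) ^ 2 + 1) ^ 2)) ^ 3) ∧
  (∀ (d L n : ℕ) [NeZero L], 1 ≤ n → ∀ x : ℝ,
      |x| < 1 / (8 * Real.exp 1 * (n : ℝ) * ((3 : ℝ) ^ d * (d : ℝ) ^ 2 + 1) ^ 2) / 2 →
      variance (wilsonAction (TrivializingMaps.StrongCoupling.defRep n))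
          (wilsonMeasure (d := d) (L := L) (TrivializingMaps.StrongCoupling.defRep n) x) ≤
        32 * Fintype.card (Plaquette d L) /
          (1 / (8 * Real.exp 1 * (n : ℝ) * ((3 : ℝ) ^ d * (d : ℝ) ^ 2 + 1) ^ 2)) ^ 2) ∧
  (∀ (d L n : ℕ) [NeZero L], 2 ≤ d → 2 ≤ n → 2 ≤ L → ∀ x : ℝ,
      |x| ≤ min (1 / (8 * Real.exp 1 * (n : ℝ) * ((3 : ℝ) ^ d * (d : ℝ) ^ 2 + 1) ^ 2) / 8)
        ((∫ g, ((g : Matrix (Fin n) (Fin n) ℂ)).trace.re ^ 2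
            ∂(haarProbability (Matrix.specialUnitaryGroup (Fin n) ℂ))) *
          (1 / (8 * Real.exp 1 * (n : ℝ) * ((3 : ℝ) ^ d * (d : ℝ) ^ 2 + 1) ^ 2)) ^ 3 / 512) →
      Metric.infDist (x : ℂ) {s : ℂ | complexMGF (fun U => -TrivializingMaps.ambWilsonAction (coeConfig U))
        (trivialMeasure (Matrix.specialUnitaryGroup (Fin n) ℂ) d L) s = 0} ≤
        8 * n / ∫ g, ((g : Matrix (Fin n) (Fin n) ℂ)).trace.re ^ 2
            ∂(haarProbability (Matrix.specialUnitaryGroup (Fin n) ℂ)))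

/-- T24 holds (`TrivializingMaps.wilson_variance_sub_le_strongCoupling`,
`….wilson_variance_le_strongCoupling`, `….wilson_infDist_zeroSet_le_strongCoupling`). -/
theorem T24_StrongCouplingSpecificHeat_holds : T24_StrongCouplingSpecificHeat :=
  ⟨fun _ _ _ _ hn hL x hx => TrivializingMaps.wilson_variance_sub_le_strongCoupling hn hL x hx,
    fun _ _ _ _ hn x hx => TrivializingMaps.wilson_variance_le_strongCoupling hn x hx,
    fun _ _ _ _ hd hn hL x hx => TrivializingMaps.wilson_infDist_zeroSet_le_strongCoupling hd hn hL x hx⟩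

end PartT24

section PartT25

/-- **T25 — THE ONE-STEP REWEIGHTING LAW** (every smooth action on `SU(n)^E`, every volume): (i) the
second moment of the weight `e^{-δS}Z(β)/Z(β+δ)` under `𝒵⁻¹e^{-βS}D[U]` equals
`exp(ψ(β+2δ) − 2ψ(β+δ) + ψ(β))`, `ψ = cgf(-S∘ι)`; (ii)/(iii) it lies in `[exp(δ²m), exp(δ²M)]` when
`m ≤ Var_u(S∘ι) ≤ M` on `[β, β+2δ]`, `δ ≥ 0`; (iv) `SU(n)` Wilson, `n ≥ 2`, `L ≥ 2`, `[β, β+2δ]` inside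
the strong-coupling window: `≥ exp(δ²·m₂(n)·#plaq/2)`. -/
def T25_ReweightingStepLaw : Prop :=
  (∀ (d L n : ℕ) [NeZero L] (S : AmbConfig d L n → ℝ), ContDiff ℝ ∞ S → ∀ β δ : ℝ,
    ∫ U, (Real.exp (-(δ * S (coeConfig U))) *
        (mgf (fun U => -S (coeConfig U)) (trivialMeasure (Matrix.specialUnitaryGroup (Fin n) ℂ) d L) β /
          mgf (fun U => -S (coeConfig U)) (trivialMeasure (Matrix.specialUnitaryGroup (Fin n) ℂ) d L)
            (β + δ))) ^ 2
      ∂(boltzmannMeasure fun U : GaugeConfig d L (Matrix.specialUnitaryGroup (Fin n) ℂ) =>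
          β * S (coeConfig U)) =
      Real.exp (cgf (fun U => -S (coeConfig U))
            (trivialMeasure (Matrix.specialUnitaryGroup (Fin n) ℂ) d L) (β + 2 * δ) -
          2 * cgf (fun U => -S (coeConfig U))
            (trivialMeasure (Matrix.specialUnitaryGroup (Fin n) ℂ) d L) (β + δ) +
          cgf (fun U => -S (coeConfig U))
            (trivialMeasure (Matrix.specialUnitaryGroup (Fin n) ℂ) d L) β)) ∧
  (∀ (d L n : ℕ) [NeZero L] (S : AmbConfig d L n → ℝ), ContDiff ℝ ∞ S → ∀ β δ m : ℝ, 0 ≤ δ →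
    (∀ u ∈ Set.Icc β (β + 2 * δ), m ≤ variance (fun U => S (coeConfig U))
      (boltzmannMeasure fun U : GaugeConfig d L (Matrix.specialUnitaryGroup (Fin n) ℂ) =>
        u * S (coeConfig U))) →
    Real.exp (δ ^ 2 * m) ≤
      ∫ U, (Real.exp (-(δ * S (coeConfig U))) *
        (mgf (fun U => -S (coeConfig U)) (trivialMeasure (Matrix.specialUnitaryGroup (Fin n) ℂ) d L) β /
          mgf (fun U => -S (coeConfig U)) (trivialMeasure (Matrix.specialUnitaryGroup (Fin n) ℂ) d L)
            (β + δ))) ^ 2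
      ∂(boltzmannMeasure fun U : GaugeConfig d L (Matrix.specialUnitaryGroup (Fin n) ℂ) =>
          β * S (coeConfig U))) ∧
  (∀ (d L n : ℕ) [NeZero L] (S : AmbConfig d L n → ℝ), ContDiff ℝ ∞ S → ∀ β δ M : ℝ, 0 ≤ δ →
    (∀ u ∈ Set.Icc β (β + 2 * δ), variance (fun U => S (coeConfig U))
      (boltzmannMeasure fun U : GaugeConfig d L (Matrix.specialUnitaryGroup (Fin n) ℂ) =>
        u * S (coeConfig U)) ≤ M) →
    ∫ U, (Real.exp (-(δ * S (coeConfig U))) *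
        (mgf (fun U => -S (coeConfig U)) (trivialMeasure (Matrix.specialUnitaryGroup (Fin n) ℂ) d L) β /
          mgf (fun U => -S (coeConfig U)) (trivialMeasure (Matrix.specialUnitaryGroup (Fin n) ℂ) d L)
            (β + δ))) ^ 2
      ∂(boltzmannMeasure fun U : GaugeConfig d L (Matrix.specialUnitaryGroup (Fin n) ℂ) =>
          β * S (coeConfig U)) ≤ Real.exp (δ ^ 2 * M)) ∧
  (∀ (d L n : ℕ) [NeZero L], 2 ≤ n → 2 ≤ L → ∀ β δ : ℝ, 0 ≤ δ →
    |β| ≤ min (1 / (8 * Real.exp 1 * (n : ℝ) * ((3 : ℝ) ^ d * (d : ℝ) ^ 2 + 1) ^ 2) / 8)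
      ((∫ g, ((g : Matrix (Fin n) (Fin n) ℂ)).trace.re ^ 2
          ∂(haarProbability (Matrix.specialUnitaryGroup (Fin n) ℂ))) *
        (1 / (8 * Real.exp 1 * (n : ℝ) * ((3 : ℝ) ^ d * (d : ℝ) ^ 2 + 1) ^ 2)) ^ 3 / 512) →
    |β + 2 * δ| ≤ min (1 / (8 * Real.exp 1 * (n : ℝ) * ((3 : ℝ) ^ d * (d : ℝ) ^ 2 + 1) ^ 2) / 8)
      ((∫ g, ((g : Matrix (Fin n) (Fin n) ℂ)).trace.re ^ 2
          ∂(haarProbability (Matrix.specialUnitaryGroup (Fin n) ℂ))) *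
        (1 / (8 * Real.exp 1 * (n : ℝ) * ((3 : ℝ) ^ d * (d : ℝ) ^ 2 + 1) ^ 2)) ^ 3 / 512) →
    Real.exp (δ ^ 2 * ((∫ g, ((g : Matrix (Fin n) (Fin n) ℂ)).trace.re ^ 2
          ∂(haarProbability (Matrix.specialUnitaryGroup (Fin n) ℂ))) * Fintype.card (Plaquette d L) / 2)) ≤
      ∫ U, (Real.exp (-(δ * TrivializingMaps.ambWilsonAction (coeConfig U))) *
        (mgf (fun U => -TrivializingMaps.ambWilsonAction (coeConfig U))
            (trivialMeasure (Matrix.specialUnitaryGroup (Fin n) ℂ) d L) β /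
          mgf (fun U => -TrivializingMaps.ambWilsonAction (coeConfig U))
            (trivialMeasure (Matrix.specialUnitaryGroup (Fin n) ℂ) d L) (β + δ))) ^ 2
      ∂(boltzmannMeasure fun U : GaugeConfig d L (Matrix.specialUnitaryGroup (Fin n) ℂ) =>
          β * TrivializingMaps.ambWilsonAction (coeConfig U)))

/-- T25 holds (`TrivializingMaps.weight_sq_integral_eq`, `….weight_sq_integral_ge_exp`,
`….weight_sq_integral_le_exp`, `….wilson_weight_sq_integral_ge_exp_strongCoupling`). -/
theorem T25_ReweightingStepLaw_holds : T25_ReweightingStepLaw :=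
  ⟨fun _ _ _ _ _ hS β δ => TrivializingMaps.weight_sq_integral_eq hS β δ,
    fun _ _ _ _ _ hS _ _ _ hδ hm => TrivializingMaps.weight_sq_integral_ge_exp hS hδ hm,
    fun _ _ _ _ _ hS _ _ _ hδ hM => TrivializingMaps.weight_sq_integral_le_exp hS hδ hM,
    fun _ _ _ _ hn hL _ _ hδ hβ hβ2 =>
      TrivializingMaps.wilson_weight_sq_integral_ge_exp_strongCoupling hn hL hδ hβ hβ2⟩

end PartT25

/-- **The theory conjunction with the closed-form Fisher-zero picture, the strong-coupling specific
heat and the one-step reweighting law** (DRAFT): `TheoryStatementT22 ∧ T23 ∧ T24 ∧ T25`. -/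
def TheoryStatementT25 : Prop :=
  TheoryStatementT22 ∧ T23_WilsonFisherZerosAnyGroup ∧ T24_StrongCouplingSpecificHeat ∧
    T25_ReweightingStepLaw

/-- The extended theory conjunction holds. -/
theorem TheoryStatementT25_holds : TheoryStatementT25 :=
  ⟨TheoryStatementT22_holds, T23_WilsonFisherZerosAnyGroup_holds, T24_StrongCouplingSpecificHeat_holds,
    T25_ReweightingStepLaw_holds⟩


/-! ### Appended (lean-2 GEN-8, corrective, LEAD LINE 229 (G2′)): the conjunction NAMED by the grant,
`TheoryStatementT23 := TheoryStatementT22 ∧ T23`, and the implication lemma `T21_of_T23` (T23 (iii) at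
`G = SU(n)`, `ρ = ρ₀`, where `Var_Haar(Re tr ρ₀) = m₂(n)`, IS Part T21 with the closed-form radius
`r(d, n)`).  No new Part.  (Parts T24/T25 above were appended beyond the G2′ grant — recorded in the
cell INBOX; they are PROVED conjuncts of tree theorems, DRAFT, and outside the adopt-ask packet unless a
lead line says otherwise.) -/

section T23ImpliesT21

/-- **T23 sharpens T21**: clause (iii) of T23 at `G = SU(n)`, `ρ = ρ₀` gives Part T21 with the
closed-form radius `ρ := 1/(4e · max(1,2n) · (3^d d² + 1)²)`. -/
theorem T21_of_T23 (h : T23_WilsonFisherZerosAnyGroup) : T21_WilsonFisherZerosExtensive := by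
  intro d n hn B
  haveI : SecondCountableTopology (Matrix (Fin n) (Fin n) ℂ) :=
    inferInstanceAs (SecondCountableTopology (Fin n → Fin n → ℂ))
  haveI : SecondCountableTopology (Matrix.specialUnitaryGroup (Fin n) ℂ) :=
    Topology.IsEmbedding.subtypeVal.secondCountableTopology
  refine ⟨1 / (4 * Real.exp 1 * max 1 (2 * (n : ℝ)) * ((3 : ℝ) ^ d * (d : ℝ) ^ 2 + 1) ^ 2),
    TrivializingMaps.kpRadiusGroup_pos d n, fun L _ hL R hR => ?_⟩
  set ρ₀ := TrivializingMaps.StrongCoupling.defRep n with hρ₀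
  have hρc : Continuous ρ₀ := continuous_subtype_val
  have hρu : ∀ g, ρ₀ g ∈ Matrix.unitaryGroup (Fin n) ℂ :=
    fun g => (Matrix.mem_specialUnitaryGroup_iff.1 g.2).1
  -- `Var_Haar(Re tr ρ₀) = m₂(n)` (`∫ Re tr = 0` for `n ≥ 2`)
  have hφc : Continuous fun g : Matrix.specialUnitaryGroup (Fin n) ℂ => (ρ₀ g).trace.re :=
    Complex.continuous_re.comp (Continuous.matrix_trace hρc)
  have hφm : MemLp (fun g : Matrix.specialUnitaryGroup (Fin n) ℂ => (ρ₀ g).trace.re) 2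
      (haarProbability (Matrix.specialUnitaryGroup (Fin n) ℂ)) :=
    MemLp.of_bound hφc.aestronglyMeasurable n (ae_of_all _ fun g => by
      have hb := Literature.RepresentationTheory.CompactGroups.CompactGroup.abs_re_trace_le_card
        ρ₀ hρc g
      rw [Fintype.card_fin] at hb
      rw [Real.norm_eq_abs]; exact hb)
  have hv : variance (fun g : Matrix.specialUnitaryGroup (Fin n) ℂ => (ρ₀ g).trace.re)
      (haarProbability (Matrix.specialUnitaryGroup (Fin n) ℂ)) =
      ∫ g, ((g : Matrix (Fin n) (Fin n) ℂ)).trace.re ^ 2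
        ∂(haarProbability (Matrix.specialUnitaryGroup (Fin n) ℂ)) := by
    rw [← covariance_self hφc.aemeasurable, covariance_eq_sub hφm hφm,
      show (fun g : Matrix.specialUnitaryGroup (Fin n) ℂ => (ρ₀ g).trace.re) =
        fun g : Matrix.specialUnitaryGroup (Fin n) ℂ => ((g : Matrix (Fin n) (Fin n) ℂ)).trace.re
        from rfl,
      TrivializingMaps.integral_re_trace_haar_eq_zero hn, mul_zero, sub_zero]
    refine integral_congr_ae (ae_of_all _ fun g => ?_)
    simp only [Pi.mul_apply, sq]
  -- the two spellings of `Z_L`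
  have hZ : complexMGF (fun U => -wilsonAction ρ₀ U)
      (trivialMeasure (Matrix.specialUnitaryGroup (Fin n) ℂ) d L) = complexMGF
        (fun U => -TrivializingMaps.ambWilsonAction (coeConfig U))
        (trivialMeasure (Matrix.specialUnitaryGroup (Fin n) ℂ) d L) := by
    congr 1
    funext U
    rw [TrivializingMaps.StrongCoupling.ambWilsonAction_coeConfig]
  obtain ⟨T, hT, hsum⟩ :=
    h.2.2.1 d L n (Matrix.specialUnitaryGroup (Fin n) ℂ) ρ₀ hρc hρu hL R hR
  simp only [hZ] at hT hsum
  rw [hv] at hsum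
  exact ⟨T, hT, hsum⟩

end T23ImpliesT21

/-- **The conjunction named by LEAD LINE 229 (G2′)** (DRAFT): `TheoryStatementT22 ∧ T23` — the
adopt-ask packet 'T / T4–T23'. -/
def TheoryStatementT23 : Prop :=
  TheoryStatementT22 ∧ T23_WilsonFisherZerosAnyGroup

/-- The packet conjunction holds. -/
theorem TheoryStatementT23_holds : TheoryStatementT23 :=
  ⟨TheoryStatementT22_holds, T23_WilsonFisherZerosAnyGroup_holds⟩

end Summit.Ventures.LatticeQCDFlow
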